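import Mathlib
import HarnessLib
import Summits.RiemannHypothesis.Statement
import Summits.RiemannHypothesis.RiemannHypothesis.Theses.RuelleBand
import Summits.RiemannHypothesis.RiemannHypothesis.Theorems.IntegerScrewDefs
import Summits.RiemannHypothesis.RiemannHypothesis.Theorems.IntegerScrewNestedSylvester
import Summits.RiemannHypothesis.RiemannHypothesis.Theorems.IntegerScrewFiniteExceptionInertia
import Summits.RiemannHypothesis.RiemannHypothesis.Theorems.IntegerScrewScrewPolyFloorZeroExpansion
import Literature.NumberTheory.LFunctions.WeilZeroSum
import Literature.Analysis.Matrix.KyFanMaximumPrinciple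
import Summits.RiemannHypothesis.RiemannHypothesis.Theorems.Splittings.ScrewBridgeRawG3

/-!
# Cell rh-split, seat rh-split-screw-bridge gen 3 — residual R1 «FozIndexBound» PROVED:
# finitely many off-line zeros ⟹ the negative index of the nested screw Gram matrices is bounded

`fozIndexBound : CofiniteCriticalLine → ∃ K, ∀ n, #{i | λ_i(screwMatrix n) < 0} ≤ K` (K = 2q, q = the
number of distinct off-line non-trivial zeros), PIVOT-LAW §11 Theorem 3(i) in the kernel.  Inputs, all in
the tree: the unconditional zero expansion of the screw form `IntegerScrewLandau.hasSum_screwForm`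
(Suzuki 2023 Thm 1.1(2)), the form identity `screwMatrix_form_eq_Icc`, the finite-exception inertia
bound `screwMatrix_finrank_negDef_le`, the Ky Fan eigen-coordinates.  New here: (i) an on-line zero
`ρ = ½ + iγ` contributes `m(ρ)|P(iγ)|²/γ² ≥ 0` to the expansion; (ii) an off-line zero contributes
`Re(w·P(a)·P(−a))`, a difference of two products of real linear forms; (iii) count ⟹ frame.
This closes residual R1 of HOME/cards/SPLIT-screw-bridge.md §8: `InertiaOfFoz ⟺ FozNonsingular` remains.

Provenance: scratch `HOME/rh-split-screw-bridge/FozIndexBoundG3.lean` (sha16 3c48ce140e920c54, 384 lines; namespace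
`…Splittings.FozIndexBoundG3`), re-homed by rh-split-typer-1 g2 in the prover lane (`Theorems/IntegerScrewFozIndexBound.lean`,
namespace `…Theorems.IntegerScrew.FozIndexBound`; this file carries DEFINITIONS — the linear forms `ycoordL`, `dirReL`,
`dirImL`, `ell₁…ell₄`, the null-sum extension `yvec`, `zeroTerm`, `zeroWeight` — hence the reviewed lane, per the
referee's note 20:54Z) on the lead's ruling 2026-08-26T20:45Z («HIGH value: closes residual R1 of T2 in the tree»); the
four negative-eigen-frame lemmas of §5 are imported from the landed `Splittings/ScrewBridgeRawG3.lean` instead of being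
restated; proofs otherwise verbatim.  Referee (rh-split-ref g0) 20:54Z: replay rc 0, std axioms on `fozIndexBound`.
Typer-1 g2 replay: farm rc 0, 0 warnings, 0 sorry, `#print axioms fozIndexBound` = [propext, Classical.choice, Quot.sound].

HONEST LABEL: an RH-free theorem about the screw matrices GIVEN finitely many off-line zeros; it is one
half of a CONDITIONAL bridge (cell rh-split: «SPLITTING SEARCH over kernel-typed RH-EQUIVALENCES; a splitting
A ∧ B ⟹ RH is CONDITIONAL bookkeeping unless A and B are both proved») and nothing here bears on the truth of RH.
-/

set_option linter.dupNamespace false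

noncomputable section

namespace Summit.RiemannHypothesis.RiemannHypothesis.Theorems.IntegerScrew.FozIndexBound

open Finset Matrix
open scoped ComplexConjugate
open Literature.Analysis.Matrix Literature.Analysis.Matrix.KyFan
open Literature.NumberTheory.LFunctions
open Summit.RiemannHypothesis.RiemannHypothesis.Theses.RuelleBand
open Summit.RiemannHypothesis.RiemannHypothesis.Theorems.IntegerScrew
open Summit.RiemannHypothesis.RiemannHypothesis.Theorems.IntegerScrewLandau
open Summit.RiemannHypothesis.RiemannHypothesis.Theorems.Splittings.ScrewBridgeRawG3

/-! ## §1 Complex bookkeeping for one zero term `m·(−P(a)P(−a))/a²` -/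

/-- **On-line terms are non-negative**: for `Re a = 0` (i.e. `ρ = ½ + a` on the critical line),
`P(−a) = conj P(a)` for a real Dirichlet polynomial `P`, `a² = −(Im a)²`, so
`m·(−P(a)P(−a))/a² = m|P(a)|²/(Im a)² ≥ 0`. [folklore] -/
theorem re_zeroTerm_nonneg_of_re_eq_zero {a : ℂ} (ha : a.re = 0) {m : ℤ} (hm : 0 ≤ m)
    (s : Finset ℕ) (y : ℕ → ℝ) :
    0 ≤ ((m : ℂ) * (-((∑ k ∈ s, ((y k : ℝ) : ℂ) * (k : ℂ) ^ a) *
        ∑ k ∈ s, ((y k : ℝ) : ℂ) * (k : ℂ) ^ (-a)) / a ^ 2)).re := by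
  set z : ℂ := ∑ k ∈ s, ((y k : ℝ) : ℂ) * (k : ℂ) ^ a with hz
  have hneg : -a = conj a := by
    apply Complex.ext <;> simp [ha]
  have hconj : ∑ k ∈ s, ((y k : ℝ) : ℂ) * (k : ℂ) ^ (-a) = conj z := by
    rw [hz, map_sum]
    refine Finset.sum_congr rfl fun k _ => ?_
    have hk : (k : ℂ).arg ≠ Real.pi := by
      rw [Complex.natCast_arg]; exact Real.pi_pos.ne
    rw [map_mul, Complex.conj_ofReal, hneg, Complex.cpow_conj _ _ hk, map_natCast]
  rw [hconj, Complex.mul_conj]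
  have hI : a = (a.im : ℂ) * Complex.I := by
    apply Complex.ext <;> simp [ha]
  have ha2 : a ^ 2 = -((a.im : ℂ) ^ 2) := by
    rw [hI, mul_pow, Complex.I_sq]; simp
  rw [ha2, neg_div_neg_eq]
  have hcast : (m : ℂ) * ((Complex.normSq z : ℂ) / (a.im : ℂ) ^ 2) =
      ((m * (Complex.normSq z / a.im ^ 2) : ℝ) : ℂ) := by
    push_cast; ring
  rw [hcast, Complex.ofReal_re]
  have hm' : (0 : ℝ) ≤ (m : ℝ) := by exact_mod_cast hm
  exact mul_nonneg hm' (div_nonneg (Complex.normSq_nonneg _) (sq_nonneg _))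

/-- **Off-line terms are differences of products of linear forms**:
`Re(m·(−pq)/a²) = (Re w·Re p − Im w·Im p)·Re q − (Re w·Im p + Im w·Re p)·Im q`, `w = −m/a²`. [folklore] -/
theorem re_zeroTerm_eq (m p q a : ℂ) :
    (m * (-(p * q) / a ^ 2)).re =
      ((-m / a ^ 2).re * p.re - (-m / a ^ 2).im * p.im) * q.re -
        ((-m / a ^ 2).re * p.im + (-m / a ^ 2).im * p.re) * q.im := by
  have : m * (-(p * q) / a ^ 2) = (-m / a ^ 2) * p * q := by ring
  rw [this]
  simp only [Complex.mul_re, Complex.mul_im]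

/-- Real part of a real-coefficient Dirichlet polynomial value. [folklore] -/
theorem re_dirPoly (s : Finset ℕ) (y : ℕ → ℝ) (a : ℂ) :
    (∑ k ∈ s, ((y k : ℝ) : ℂ) * (k : ℂ) ^ a).re = ∑ k ∈ s, y k * ((k : ℂ) ^ a).re := by
  rw [Complex.re_sum]
  exact Finset.sum_congr rfl fun k _ => Complex.re_ofReal_mul _ _

/-- Imaginary part of a real-coefficient Dirichlet polynomial value. [folklore] -/
theorem im_dirPoly (s : Finset ℕ) (y : ℕ → ℝ) (a : ℂ) :
    (∑ k ∈ s, ((y k : ℝ) : ℂ) * (k : ℂ) ^ a).im = ∑ k ∈ s, y k * ((k : ℂ) ^ a).im := by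
  rw [Complex.im_sum]
  exact Finset.sum_congr rfl fun k _ => Complex.im_ofReal_mul _ _

/-! ## §2 The vector `v : Fin n → ℝ` as a null-sum sequence `y` on `[1, n+1]`, linearly -/

/-- The `k`-th coefficient of the null-sum extension of `v`: `y₁ = −Σ v`, `y_{i+2} = v_i`, else `0`,
as a linear form in `v`. [folklore] -/
def ycoordL (n k : ℕ) : (Fin n → ℝ) →ₗ[ℝ] ℝ :=
  if h : 2 ≤ k ∧ k ≤ n + 1 then LinearMap.proj (⟨k - 2, by omega⟩ : Fin n)
  else if k = 1 then -∑ i : Fin n, LinearMap.proj i else 0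

/-- The null-sum extension of `v`. [folklore] -/
def yvec (n : ℕ) (v : Fin n → ℝ) : ℕ → ℝ := fun k => ycoordL n k v

/-- `y_{i+2} = v_i`. [folklore] -/
theorem yvec_add_two (n : ℕ) (v : Fin n → ℝ) (i : Fin n) : yvec n v ((i : ℕ) + 2) = v i := by
  show ycoordL n ((i : ℕ) + 2) v = v i
  unfold ycoordL
  rw [dif_pos ⟨by omega, by omega⟩, LinearMap.proj_apply]
  congr 1

/-- `y_1 = −Σ_i v_i`. [folklore] -/
theorem yvec_one (n : ℕ) (v : Fin n → ℝ) : yvec n v 1 = -∑ i, v i := by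
  show ycoordL n 1 v = -∑ i, v i
  unfold ycoordL
  rw [dif_neg (by omega), if_pos rfl, LinearMap.neg_apply, LinearMap.sum_apply]
  simp

/-- `Σ_{k ≤ n+1} y_k = 0`. [folklore] -/
theorem yvec_sum_zero (n : ℕ) (v : Fin n → ℝ) : ∑ k ∈ Icc 1 (n + 1), yvec n v k = 0 := by
  have hsplit : Finset.Icc 1 (n + 1) = insert 1 (Finset.Icc 2 (n + 1)) := by
    ext k; simp only [Finset.mem_Icc, Finset.mem_insert]; omega
  rw [hsplit, Finset.sum_insert (by simp), sum_Icc_two_eq_sum_fin, yvec_one]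
  simp only [yvec_add_two]
  ring

/-- `Re P_v(a)` / `Im P_v(a)` as linear forms in `v` (`P_v(a) = Σ_{k ≤ n+1} y_k k^a`). [folklore] -/
def dirReL (n : ℕ) (a : ℂ) : (Fin n → ℝ) →ₗ[ℝ] ℝ :=
  ∑ k ∈ Icc 1 (n + 1), ((k : ℂ) ^ a).re • ycoordL n k

/-- See `dirReL`. [folklore] -/
def dirImL (n : ℕ) (a : ℂ) : (Fin n → ℝ) →ₗ[ℝ] ℝ :=
  ∑ k ∈ Icc 1 (n + 1), ((k : ℂ) ^ a).im • ycoordL n k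

/-- `dirReL n a v = Re P_v(a)`. [folklore] -/
theorem dirReL_apply (n : ℕ) (a : ℂ) (v : Fin n → ℝ) :
    dirReL n a v = (∑ k ∈ Icc 1 (n + 1), ((yvec n v k : ℝ) : ℂ) * (k : ℂ) ^ a).re := by
  rw [re_dirPoly, dirReL, LinearMap.sum_apply]
  refine Finset.sum_congr rfl fun k _ => ?_
  rw [LinearMap.smul_apply, smul_eq_mul, mul_comm]
  rfl

/-- `dirImL n a v = Im P_v(a)`. [folklore] -/
theorem dirImL_apply (n : ℕ) (a : ℂ) (v : Fin n → ℝ) :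
    dirImL n a v = (∑ k ∈ Icc 1 (n + 1), ((yvec n v k : ℝ) : ℂ) * (k : ℂ) ^ a).im := by
  rw [im_dirPoly, dirImL, LinearMap.sum_apply]
  refine Finset.sum_congr rfl fun k _ => ?_
  rw [LinearMap.smul_apply, smul_eq_mul, mul_comm]
  rfl

/-! ## §3 The zero expansion of `vᵀ S_n v`, split at a finite set of zeros -/

/-- The `ρ`-term of the zero expansion of the screw form at `v`. [folklore] -/
def zeroTerm (n : ℕ) (v : Fin n → ℝ) (ρ : ℂ) : ℂ :=
  (riemannZetaZeroOrder ρ : ℂ) *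
    (-((∑ m ∈ Icc 1 (n + 1), ((yvec n v m : ℝ) : ℂ) * (m : ℂ) ^ (ρ - 1 / 2)) *
        ∑ m ∈ Icc 1 (n + 1), ((yvec n v m : ℝ) : ℂ) * (m : ℂ) ^ (-(ρ - 1 / 2))) /
      (ρ - 1 / 2) ^ 2)

/-- **Zero expansion of the screw form** (Suzuki 2023 Thm 1.1(2) via `hasSum_screwForm` and
`screwMatrix_form_eq_Icc`): `vᵀ S_n v = Σ_ρ zeroTerm n v ρ`, absolutely. [cite: Suzuki2023, Thm. 1.1 (2)] -/
theorem hasSum_zeroTerm (n : ℕ) (v : Fin n → ℝ) :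
    HasSum (fun ρ : ZetaZeros.riemannZetaNontrivialZeros => zeroTerm n v (ρ : ℂ))
      ((star v ⬝ᵥ (screwMatrix n *ᵥ v) : ℝ) : ℂ) := by
  have h := hasSum_screwForm (n + 1) (by omega) (yvec n v) (yvec_sum_zero n v)
  rw [screwMatrix_form_eq_Icc n v (yvec n v) (yvec_add_two n v)]
  exact h

/-- Real parts: `vᵀ S_n v = Σ_ρ Re(zeroTerm n v ρ)`. [folklore] -/
theorem hasSum_re_zeroTerm (n : ℕ) (v : Fin n → ℝ) :
    HasSum (fun ρ : ZetaZeros.riemannZetaNontrivialZeros => (zeroTerm n v (ρ : ℂ)).re)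
      (star v ⬝ᵥ (screwMatrix n *ᵥ v)) := by
  have h := ((Complex.hasSum_iff _ _).mp (hasSum_zeroTerm n v)).1
  rwa [Complex.ofReal_re] at h

/-- An on-line zero contributes a non-negative term. [folklore] -/
theorem re_zeroTerm_nonneg (n : ℕ) (v : Fin n → ℝ) {ρ : ℂ}
    (hρ : ρ ∈ ZetaZeros.riemannZetaNontrivialZeros) (hre : ρ.re = 1 / 2) :
    0 ≤ (zeroTerm n v ρ).re := by
  have ha : (ρ - 1 / 2).re = 0 := by
    rw [Complex.sub_re, hre]; simp
  exact re_zeroTerm_nonneg_of_re_eq_zero ha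
    (le_trans zero_le_one (ZetaZeros.riemannZetaNontrivialZeros.one_le_order hρ)) _ _

/-- **The off-line part is dominated by the form**: if every zero outside the finite set `F` lies on
the critical line, `Σ_{ρ ∈ F} Re(zeroTerm n v ρ) ≤ vᵀ S_n v`. [folklore] -/
theorem sum_re_zeroTerm_le_form (F : Finset ZetaZeros.riemannZetaNontrivialZeros)
    (hF : ∀ ρ : ZetaZeros.riemannZetaNontrivialZeros, ρ ∉ F → (ρ : ℂ).re = 1 / 2)
    (n : ℕ) (v : Fin n → ℝ) :
    ∑ ρ ∈ F, (zeroTerm n v (ρ : ℂ)).re ≤ star v ⬝ᵥ (screwMatrix n *ᵥ v) := by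
  have h := hasSum_re_zeroTerm n v
  have hsplit := h.summable.sum_add_tsum_subtype_compl F
  rw [h.tsum_eq] at hsplit
  have hnn : 0 ≤ ∑' ρ : {ρ : ZetaZeros.riemannZetaNontrivialZeros // ρ ∉ F},
      (zeroTerm n v ((ρ : ZetaZeros.riemannZetaNontrivialZeros) : ℂ)).re :=
    tsum_nonneg fun ρ => re_zeroTerm_nonneg n v ρ.1.2 (hF ρ.1 ρ.2)
  linarith

/-! ## §4 The off-line part as `Σ_j (ℓ₁ⱼℓ₃ⱼ − ℓ₂ⱼℓ₄ⱼ)(v)` -/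

/-- The weight `w(ρ) = −m(ρ)/(ρ−½)²`. [folklore] -/
def zeroWeight (ρ : ℂ) : ℂ := -(riemannZetaZeroOrder ρ : ℂ) / (ρ - 1 / 2) ^ 2

/-- The four linear forms of an off-line zero. [folklore] -/
def ell₁ (n : ℕ) (ρ : ℂ) : (Fin n → ℝ) →ₗ[ℝ] ℝ :=
  (zeroWeight ρ).re • dirReL n (ρ - 1 / 2) - (zeroWeight ρ).im • dirImL n (ρ - 1 / 2)

/-- See `ell₁`. [folklore] -/
def ell₂ (n : ℕ) (ρ : ℂ) : (Fin n → ℝ) →ₗ[ℝ] ℝ :=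
  (zeroWeight ρ).re • dirImL n (ρ - 1 / 2) + (zeroWeight ρ).im • dirReL n (ρ - 1 / 2)

/-- See `ell₁`. [folklore] -/
def ell₃ (n : ℕ) (ρ : ℂ) : (Fin n → ℝ) →ₗ[ℝ] ℝ := dirReL n (-(ρ - 1 / 2))

/-- See `ell₁`. [folklore] -/
def ell₄ (n : ℕ) (ρ : ℂ) : (Fin n → ℝ) →ₗ[ℝ] ℝ := dirImL n (-(ρ - 1 / 2))

/-- `Re(zeroTerm n v ρ) = ℓ₁(v)ℓ₃(v) − ℓ₂(v)ℓ₄(v)`. [folklore] -/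
theorem re_zeroTerm_eq_ell (n : ℕ) (v : Fin n → ℝ) (ρ : ℂ) :
    (zeroTerm n v ρ).re = ell₁ n ρ v * ell₃ n ρ v - ell₂ n ρ v * ell₄ n ρ v := by
  rw [zeroTerm, re_zeroTerm_eq]
  simp only [ell₁, ell₂, ell₃, ell₄, zeroWeight, LinearMap.sub_apply, LinearMap.add_apply,
    LinearMap.smul_apply, smul_eq_mul, dirReL_apply, dirImL_apply]

/-! ## §5 Count ⟹ subspace (the converse half of the Courant–Fischer count) -/

section Frames

variable {ι : Type*} [Fintype ι] [DecidableEq ι] {κ : Type*} [Fintype κ]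

-- The frame lemmas `eigvec_dotProduct_sum_smul`, `eigvec_dotProduct_sum_smul_of_notMem`, `frame_form_lt`,
-- `exists_frame_of_card_le` are the landed ones of `Theorems/Splittings/ScrewBridgeRawG3.lean` (same seat, p465620).

/-- **Count ⟹ subspace**: if every subspace on which `xᵀWx < 0` (`x ≠ 0`) has dimension `≤ K`, then
`W` has at most `K` negative eigenvalues (span of a negative eigen-frame). [folklore] -/
theorem card_eigenvalues_neg_le_of_subspace_bound {W : Matrix ι ι ℝ} (hW : W.IsHermitian) (K : ℕ)
    (h : ∀ N : Submodule ℝ (ι → ℝ), (∀ x ∈ N, x ≠ 0 → x ⬝ᵥ W *ᵥ x < 0) → Module.finrank ℝ N ≤ K) :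
    (univ.filter fun i => hW.eigenvalues i < 0).card ≤ K := by
  by_contra hlt
  rw [not_le] at hlt
  have hle : Fintype.card (Fin (K + 1)) ≤ (univ.filter fun i => hW.eigenvalues i < 0).card := by
    rw [Fintype.card_fin]; exact hlt
  obtain ⟨v, hv⟩ := exists_frame_of_card_le hW hle
  have hv0 : ∀ c : Fin (K + 1) → ℝ, c ≠ 0 → (∑ b, c b • v b) ⬝ᵥ W *ᵥ (∑ b, c b • v b) < 0 := by
    intro c hc
    have := hv c hc
    rwa [zero_mul] at this
  have hli : LinearIndependent ℝ v := by
    rw [Fintype.linearIndependent_iff]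
    intro c hc
    by_contra hne
    push Not at hne
    have hc0 : c ≠ 0 := by
      obtain ⟨i, hi⟩ := hne
      exact fun h => hi (by rw [h]; rfl)
    have := hv0 c hc0
    rw [hc] at this
    simp at this
  have hN := h (Submodule.span ℝ (Set.range v)) (by
    intro x hx hx0
    obtain ⟨c, rfl⟩ := Submodule.mem_span_range_iff_exists_fun ℝ |>.mp hx
    have hc0 : c ≠ 0 := by
      rintro rfl
      exact hx0 (by simp)
    exact hv0 c hc0)
  rw [finrank_span_eq_card hli, Fintype.card_fin] at hN
  omega

end Frames

/-! ## §6 The theorem -/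

/-- **R1 «FozIndexBound» (PIVOT-LAW §11 Theorem 3(i))**: if only finitely many non-trivial zeros lie
off the critical line — `q` distinct ones — then every screw Gram matrix `S_n` has at most `2q`
negative eigenvalues. [folklore] -/
theorem fozIndexBound (hfoz : CofiniteCriticalLine) :
    ∃ K : ℕ, ∀ n : ℕ,
      (Finset.univ.filter fun i => (screwMatrix_isHermitian n).eigenvalues i < 0).card ≤ K := by
  classical
  -- the off-line zeros as a finite set of the index type
  have hfin : (Subtype.val ⁻¹'
      {s : ℂ | riemannZeta s = 0 ∧ 0 < s.re ∧ s.re < 1 ∧ s.re ≠ 1 / 2} :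
        Set ZetaZeros.riemannZetaNontrivialZeros).Finite :=
    Set.Finite.preimage Subtype.val_injective.injOn hfoz
  set F : Finset ZetaZeros.riemannZetaNontrivialZeros := hfin.toFinset with hFdef
  have hF : ∀ ρ : ZetaZeros.riemannZetaNontrivialZeros, ρ ∉ F → (ρ : ℂ).re = 1 / 2 := by
    intro ρ hρ
    by_contra hne
    apply hρ
    rw [hFdef, Set.Finite.mem_toFinset]
    obtain ⟨hz, h0, h1⟩ := ZetaZeros.riemannZetaNontrivialZeros.mem_iff'.1 ρ.2
    exact ⟨hz, h0, h1, hne⟩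
  refine ⟨2 * F.card, fun n => ?_⟩
  -- index the off-line zeros by `Fin F.card`
  let e : Fin F.card ≃ {ρ // ρ ∈ F} := F.equivFin.symm
  let L₁ : Fin F.card → ((Fin n → ℝ) →ₗ[ℝ] ℝ) := fun j => ell₁ n ((e j : ZetaZeros.riemannZetaNontrivialZeros) : ℂ)
  let L₂ : Fin F.card → ((Fin n → ℝ) →ₗ[ℝ] ℝ) := fun j => ell₂ n ((e j : ZetaZeros.riemannZetaNontrivialZeros) : ℂ)
  let L₃ : Fin F.card → ((Fin n → ℝ) →ₗ[ℝ] ℝ) := fun j => ell₃ n ((e j : ZetaZeros.riemannZetaNontrivialZeros) : ℂ)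
  let L₄ : Fin F.card → ((Fin n → ℝ) →ₗ[ℝ] ℝ) := fun j => ell₄ n ((e j : ZetaZeros.riemannZetaNontrivialZeros) : ℂ)
  have hoff : ∀ x : Fin n → ℝ, ∑ j, (L₁ j x * L₃ j x - L₂ j x * L₄ j x) =
      ∑ ρ ∈ F, (zeroTerm n x (ρ : ℂ)).re := by
    intro x
    simp only [L₁, L₂, L₃, L₄, ← re_zeroTerm_eq_ell]
    rw [Equiv.sum_comp e (fun ρ : {ρ // ρ ∈ F} =>
      (zeroTerm n x ((ρ : ZetaZeros.riemannZetaNontrivialZeros) : ℂ)).re)]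
    exact Finset.sum_coe_sort F
      (fun ρ : ZetaZeros.riemannZetaNontrivialZeros => (zeroTerm n x (ρ : ℂ)).re)
  apply card_eigenvalues_neg_le_of_subspace_bound (screwMatrix_isHermitian n)
  intro N hN
  refine screwMatrix_finrank_negDef_le
    (P := fun x => x ⬝ᵥ (screwMatrix n *ᵥ x) - ∑ j, (L₁ j x * L₃ j x - L₂ j x * L₄ j x))
    ?_ L₁ L₂ L₃ L₄ (fun x => by ring) N hN
  intro x
  have := sum_re_zeroTerm_le_form F hF n x
  rw [star_trivial] at this
  rw [hoff]
  linarith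

end Summit.RiemannHypothesis.RiemannHypothesis.Theorems.IntegerScrew.FozIndexBound

end
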